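import Literature.MathematicalPhysics.QuantumFieldTheory.Balaban1983to89.B15Prop1GaugeRetractionOfGaugeSection
import Literature.MathematicalPhysics.QuantumFieldTheory.Balaban1983to89.B15DeterminingSetsB

/-!
# `Balaban1983to89.B15Prop1GaugeRetractionOfGaugeSection` — [Balaban1985Variational] = «[15]», (4) p. 278, (16)–(18) p. 280, Thm 1 p. 279; [Balaban1985RegularSpaces] = «[6]», — **BOND-DATUM EDITION** (`…B15Prop1GaugeRetractionOfGaugeSectionB`, USED DECLARATIONS ONLY): the print-datum ([Balaban1984PropagatorsII] (2.3)) twins of the declarations of `B15Prop1GaugeRetractionOfGaugeSection` that N12's junction of record v14ᴸ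
uses with a datum-bearing statement (`agreeOn_gaugeAct_of_residual`) — class (γ) of dag-n12-c's census-by-declaration v2 (bus [DAGN12C-G35], 2026-08-30).  GENERATOR (block-extracted from the
parent's tree bytes by HOME `lean/g35/gen/gen_blocks.py`): namespace `…B`, SAME names, `DetSet ↦ BDetSet` (F0a), `AgreeOn ↦ AgreeOnB`, `IsMinimizer ↦ IsMinimizerB`, `bondsOf (𝐁 j) ↦ 𝔅 j`, `constrCard ∕
constrEnum ∕ ConstrSet ∕ msChart ↦ …B` (lane `Node00/MultiScaleFibreChartB`), `IsCritOnFibre ∕ IsFibreChartNear ↦ …B`; proofs VERBATIM; the parent's other (datum-free) declarations REUSED by `open`.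

statement-level skeleton of published theorems with citation tags; proofs where landed; nothing here is a claim about
the Yang–Mills mass gap

Cell `pub-ymgap` (HUMAN RULINGS D-0062 ∕ D-0149), lane `pub-ymgap-dag-n12-c` g35 (R134 seat (a), N12 = [B15], s1, lane owner); `--kind proof --supports` K1⁹ `stmt-QuantumFields-27364`; count-neutral.
THEOREMS ONLY (0 `def`, 0 `instance`, 0 `sorry`).  HONESTY GUARD (director-ym №338 (5)): PURELY ADDITIVE — the parent stays landed and true on its own text; nothing in it is edited; no displayed
premise of any consumer is deleted or weakened; every hypothesis stays a hypothesis.  Nothing of Bałaban's analysis asserted; N12 NOT discharged; K0⁷ ∕ K1⁹ NOT closed; one finite 𝕋⁴ programme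
at fixed ε — nothing continuum ∕ ℝ⁴ ∕ OS; the Yang–Mills mass gap (Clay) is NOT proved by any of this.

PARENT's DOCSTRING (mathematics and citations; read `𝐁` as the bond datum `𝔅`):
# `Balaban1983to89.B15Prop1GaugeRetractionOfGaugeSection` — [Balaban1985Variational] = «[15]», (4) p. 278, (16)–(18) p. 280, Thm 1 p. 279; [Balaban1985RegularSpaces] = «[6]»,
# (1.19) p. 79 (`Ax_k(𝔅_k, U₀)`); [Balaban1985Averaging] (11) p. 19 («Ū^u = (Ū)^u»), (21) p. 21; [Balaban1988Convergent] = «[III]», (0.2) p. 244, (2.10)–(2.12) p. 256: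
# THE GAUGE-RETRACTION LETTER `hπ` OF `B15Prop1CritTransferOfGaugeRetraction` FROM A RESIDUAL GAUGE-FIXING MAP — after this file the ONLY displayed datum of the N12
# criticality transfer is the `𝐁`-ADAPTED AXIAL GAUGE-FIXING MAP itself (four print-shaped clauses (σ1)–(σ4), [6] (1.19)); its degenerate instance `σ := 1` at the full slice
# inhabits `hπ` (A6 non-vacuity)

Honest framing: statement-level skeleton of published theorems with citation tags; proofs where landed; nothing here is a claim about the
Yang–Mills mass gap.  Cell `pub-ymgap`, HUMAN RULING D-0149 ∕ director-ym R399 (3a) (width seats), seat `pub-ymgap-dag-n12-w6` (g0; N12 = [B15]); `--kind proof --supports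
stmt-QuantumFields-20542`; count-neutral; N12 NOT discharged; finite 𝕋⁴ at fixed ε; nothing continuum ∕ ℝ⁴ ∕ OS ∕ mass-gap ∕ Clay.

WHY.  `B15Prop1CritTransferOfGaugeRetraction.hcritT_curve_of_gaugeRetraction` proves the criticality transfer `hcritT` of dag-n12-w1's local minimiser chart modulo ONE displayed
letter `hπ`: near `(0, ↑Q₀)`, every fibre curve `γ` through a slice-chart point `U′` is carried by a slice curve `X` (differentiable at `0`, `X 0 = w.1`) whose chart images are
`SU(2)` fields with the same Wilson action and still on the fibre.  Print supplies `hπ` by GAUGE FIXING ([15] p. 280: «Using the transformations (16) with u satisfying (4) we fix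
the axial gauge conditions Ax_k(𝔅_k, U₀) … The functional (5) is gauge invariant, hence it is enough to consider it on the space (18)»).  THIS FILE performs that reduction in the
kernel: from a gauge-fixing MAP `σ : U ↦ u(U)` with four print-shaped properties — (σ1) it does not move the slice chart (`σ (exp(X)·U₀) = 1` for `X ∈ S`), (σ2) it moves every
configuration INTO the slice chart in the logarithmic coordinates relative to `U₀` ([15] p. 307 «B = (1∕i) log V»), (σ3) it is differentiable along differentiable curves, (σ4) it is
RESIDUAL ((4): trivial at the block towers of the constrained bonds of `𝐁`) — the letter `hπ` follows, the action clause by gauge invariance of (5) (r11's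
`B14Eq16FaddeevPopov.wilsonAction4_gaugeAct'`) and the fibre clause by the gauge covariance of the iterated averaging (r13's `B16Sect1Backgrounds.iter_gaugeAct`, [Balaban1985Averaging]
(11)) killed at the constrained bonds by (σ4).  The slice curve is the logarithmic chart of the gauge-fixed curve (`B15SU2ChartHolomorphic.logCoordC`, inverse identities
`logCoordC_expPointC` ∕ `expPointC_logCoordC`), carried into the submodule `S` by a continuous linear projection (finite dimension).

CONTENTS (theorems only; no `def`, no `instance`, no `sorry`).  §1 small plumbing (`gaugeAct_apply_eq_of_trivial`, `agreeOn_gaugeAct_of_residual` — the residual group (4) preserves the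
fibre (3) —, `det_coe_mul_star_coe`, `logCoordC_coe_mul_star_of_expMulC_eq`, `expPointC_logCoordC_mul_coe` — chart∕log identities at `SU(2)` points).  §2 ★★★ `gaugeRetraction_of_gaugeSection` — (σ1)–(σ4) + `k ≤ m + K` + `𝐁` of levels `≤ k` ⟹ the letter `hπ` of `hcritT_curve_of_gaugeRetraction` VERBATIM.
§3 ★★ `hcritT_curve_of_gaugeSection` ∕ `hcritT_isCritOnFibre_of_gaugeSection` — the composition: w1's `hcritT` binder at curve-criticality (resp. n07-e's `Node00.IsCritOnFibre` at the
record) from the base-field data and (σ1)–(σ4).  §4 ★ `gaugeRetraction_top` — NON-VACUITY: at the full slice `S = ⊤` the trivial gauge `σ := 1` satisfies (σ1)–(σ4), so `hπ` holds there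
outright (the degenerate witness; on `⊤` the companion letter (β) of the chart fails — the honest instance is the axial gauge of [6] (1.19), dag-n12-w3's `hierAxial` objects).

HONEST FRAMING: kernel bookkeeping (chain rule, logarithmic chart, gauge covariance); nothing of Bałaban's asserted; the axial gauge-fixing map for a genuine gauge slice stays
displayed ((σ1)–(σ4)); (E) and `hT1u` stay displayed in the lane; N12 NOT discharged; K1⁷ NOT closed; counts unmoved; one finite 𝕋⁴ programme at fixed ε — NOT continuum ∕ ℝ⁴ ∕
OS ∕ mass gap ∕ Clay.
-/


noncomputable section

namespace Literature.MathematicalPhysics.QuantumFieldTheory.Balaban1983to89.B15Prop1GaugeRetractionOfGaugeSectionB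

open B15Prop1GaugeRetractionOfGaugeSection


open Set Metric Filter
open scoped Topology
open Literature.MathematicalPhysics.QuantumFieldTheory.Balaban1983to89.Node00 (SU coeField coeField_apply SmallBelow IsCritOnFibre
  avOfRecord star_coe_mul_coe_SU coe_mul_star_coe_SU)
open B15AveragingHolomorphic (iterMh)
open B15SU2ChartHolomorphic (genE expPointC expMulC logCoordC logCoordC_expPointC expPointC_logCoordC differentiableAt_logCoordC det_expPointC)
open B15Prop1DatumCoordinates (expMulC_zero_left)
open B15Prop1CritTransferOfGaugeRetraction (hcritT_curve_of_gaugeRetraction hcritT_isCritOnFibre_of_gaugeRetraction)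
open B16Sect1Backgrounds (toMS iter_gaugeAct)
open B14Eq16FaddeevPopov (wilsonAction4_gaugeAct')
open ExpMeanLog (expMeanLogSU)
open BlockAveraging (blockAvg)
open T4CubeChartGnomonic (SU2)
open T4Continuum B15DeterminingSets B15DeterminingSetsB GaugeField
open scoped Matrix.Norms.L2Operator

variable {P : Params}



section

/-- **THE RESIDUAL GROUP (4) PRESERVES THE FIBRE (3)**: if `u` is trivial on the block towers under the endpoints of the bonds of `𝐁` (levels `≤ k ≤ m + K`, `𝐁` of levels
`≤ k`), then `U^u` has the same averages on `𝐁` as `U` (gauge covariance of the iterated averages, [Balaban1985Averaging] (11), r13's `iter_gaugeAct`). [cite: Balaban1985Variational, (3)–(4) p.278; Balaban1985Averaging, (11) p.19; Balaban1988Convergent, (2.10)–(2.11) p.256] -/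
theorem agreeOn_gaugeAct_of_residual (av : ∀ j, Averaging P j SU2) (𝔅 : BDetSet P) {k : ℕ} (hk : k ≤ P.m + P.K)
    (h𝔅 : ∀ j, k < j → 𝔅 j = ∅) {u : GaugeTransf P 0 SU2}
    (hu : ∀ j, j ≤ k → ∀ b ∈ (𝔅 j), toMS u j b.src = 1 ∧ toMS u j b.tgt = 1) (U : GaugeField P 0 SU2) :
    AgreeOnB 𝔅 (avgFamily av (gaugeAct u U)) (avgFamily av U) := by
  intro j b hb
  by_cases hjk : k < j
  · rw [h𝔅 j hjk] at hb
    simp at hb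
  have hj : j ≤ k := Nat.le_of_not_lt hjk
  show Averaging.iter av j (gaugeAct u U) b = Averaging.iter av j U b
  rw [iter_gaugeAct av u U j (hj.trans hk)]
  exact gaugeAct_apply_eq_of_trivial (hu j hj b hb).1 (hu j hj b hb).2

end

end Literature.MathematicalPhysics.QuantumFieldTheory.Balaban1983to89.B15Prop1GaugeRetractionOfGaugeSectionB

end
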